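import Mathlib
import Summits.Ventures.PercRepro2.HCov
import Summits.Ventures.PercRepro2.RECMReduction
import Summits.Ventures.PercRepro2.CCWReduced
import Summits.Ventures.PercRepro2.GcSkelRules
import Summits.Ventures.PercRepro2.GcSkelReductionT
import Summits.Ventures.PercRepro2.GcSkelReductionO
import Summits.Ventures.PercRepro2.OStarGlue
import Summits.Ventures.PercRepro2.BStarGlue
import Summits.Ventures.PercRepro2.A3BStarGlue

/-!
# The residual minus the star of `b` and the `{a₃, b}`-star of `o` (blind cell PercRepro2,
typer-1 g54)

mine-2 g39's two mirrors of the star theorem (`CovForm.OStar.HCov_of_bstar`, BStarGlue p673132: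
every edge at `b` leads to `a₁`, `a₂` or `o`; `CovForm.OStar.HCov_of_a3bstar`, A3BStarGlue
p673313: every edge at `o` leads to `a₃` or `b`), folded into the weighted residual by the
pattern of `GcSkelReductionO.lean`:

* the `b`-star is `OToMarks ends b a₁ a₂ o` (the same predicate with the poles exchanged);
  **`HCov_of_bToMarks`** on simple graphs, through `exists_star_of_oToMarks` at `b`;
* **`OTwoToMarks ends o x y`** — every non-loop edge at `o` is `{o, x}` or `{o, y}`;
  `exists_star_none_of_oTwoToMarks` (the relocated map is a `Star` with the middle slot `none`);
  **`HCov_of_oA3BToMarks`**;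
* **`WReducedOB`** := `WReducedO` ∧ ¬ `OToMarks ends b a₁ a₂ o` ∧ ¬ `OTwoToMarks ends o a₃ b`;
  **`HCov_all_iff_HCovWRedOB_all`**; on the residual `b` has a non-loop edge to a vertex other
  than `a₁, a₂, o` (`exists_b_edge_off_of_wredOB`) and `o` one to a vertex other than `a₃, b`
  (`exists_o_edge_off_a3b_of_wredOB`) — with `exists_o_edge_off_of_wredO`, `o` and `b` each have
  a non-loop edge to an unmarked vertex or to `a₃`, and `o` one more outside `{a₃, b}`.
-/

namespace Summit.Ventures.PercRepro2

open CovForm RECM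

namespace WRed

/-! ## The two-target star of `o` -/

section TwoTargets

variable {V : Type*} {E : Type*} [DecidableEq V]

/-- **The two-target star class of `o`, loops ignored**: every non-loop edge at `o` is `{o, x}` or
`{o, y}`. -/
def OTwoToMarks (ends : E → Sym2 V) (o x y : V) : Prop :=
  ∀ e, o ∈ ends e → ¬ (ends e).IsDiag → ends e = s(o, x) ∨ ends e = s(o, y)

open Classical in
/-- **The slots from simplicity, middle slot empty**: on a simple graph in the two-target star
class `{x, y}` of `o`, the relocated map is a `Star` (in mine-2's parametrisation
`Star ends o x m y'`) whose middle slot is `none`. -/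
theorem exists_star_none_of_oTwoToMarks {ends : E → Sym2 V} (hsimp : Simple ends)
    {o x m y : V} (h : OTwoToMarks ends o x y) (hox : o ≠ x) (hom : o ≠ m) (hoy : o ≠ y)
    (hxm : x ≠ m) (hxy : x ≠ y) (hmy : m ≠ y) {z : V} (hoz : o ≠ z) :
    ∃ e₁ eb : Option E, CovForm.OStar.Star (relocateO ends o x) o x m z y e₁ none eb := by
  let slot : V → Option E := fun t =>
    if ht : ∃ e, ends e = s(o, t) then some (Classical.choose ht) else none
  have hslot : ∀ t, t ≠ o → ∀ e, slot t = some e → relocateO ends o x e = s(o, t) := by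
    intro t hto e he
    simp only [slot] at he
    split_ifs at he with ht
    · have hc := Classical.choose_spec ht
      rw [Option.some_inj] at he
      subst he
      rw [relocateO_agree ends o x _ (by rw [hc, Sym2.mk_isDiag_iff]; exact fun h => hto h.symm)]
      exact hc
  have hall : ∀ e, o ∈ relocateO ends o x e → slot x = some e ∨ none = some e ∨ slot y = some e := by
    intro e he
    have hnd := not_loop_at_o_relocateO hox he
    rw [relocateO_agree' ends o x e hnd] at he hnd
    have key : ∀ t, t ≠ o → ends e = s(o, t) → slot t = some e := by
      intro t hto hex
      have ht : ∃ e', ends e' = s(o, t) := ⟨e, hex⟩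
      simp only [slot, dif_pos ht]
      congr 1
      by_contra hne
      exact hsimp _ _ (Ne.symm hne) (by rw [hex, Sym2.mk_isDiag_iff]; exact fun h => hto h.symm)
        (by rw [hex, Classical.choose_spec ht])
    rcases h e he hnd with hx | hy
    · exact Or.inl (key x hox.symm hx)
    · exact Or.inr (Or.inr (key y hoy.symm hy))
  exact ⟨slot x, slot y, ⟨hslot x hox.symm, (fun _ he => nomatch he),
    hslot y hoy.symm, hall, hox, hom, hoz, hoy, hxm, hxy, hmy⟩⟩

end TwoTargets

/-! ## (HCOV) on the two mirror classes -/

section Mirrors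

variable {V : Type*} {E : Type*} [Fintype E] [DecidableEq E] [DecidableEq V] {R : Type*}
  [Field R] [LinearOrder R] [IsStrictOrderedRing R]

/-- **(HCOV) on the loop-ignored star class of `b`** (every non-loop edge at `b` leads to `a₁`,
`a₂` or `o`) of a simple graph, through mine-2 g39's `HCov_of_bstar`. -/
theorem HCov_of_bToMarks {ends : E → Sym2 V} (hsimp : Simple ends) {o a₁ a₂ a₃ b : V}
    (h : OToMarks ends b a₁ a₂ o) (hb1 : b ≠ a₁) (hb2 : b ≠ a₂) (hb3 : b ≠ a₃) (hob : o ≠ b)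
    (h12 : a₁ ≠ a₂) (ho1 : o ≠ a₁) (ho2 : o ≠ a₂) (p : E → R) (hp : IsProbVec p) :
    HCov p ends o a₁ a₂ a₃ b := by
  classical
  obtain ⟨e₁, e₂, eo, hS⟩ := exists_star_of_oToMarks hsimp h hb1 hb2 hb3 hob.symm h12 ho1 ho2
  unfold HCov
  rw [Gc_eq_of_agree_nonLoop p (relocateO_agree ends b a₁) (relocateO_agree' ends b a₁)]
  exact CovForm.OStar.HCov_of_bstar hS p hp

/-- **(HCOV) on the loop-ignored `{a₃, b}`-star class of `o`** (every non-loop edge at `o` leads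
to `a₃` or `b`) of a simple graph, through mine-2 g39's `HCov_of_a3bstar`. -/
theorem HCov_of_oA3BToMarks {ends : E → Sym2 V} (hsimp : Simple ends) {o a₁ a₂ a₃ b : V}
    (h : OTwoToMarks ends o a₃ b) (ho1 : o ≠ a₁) (ho2 : o ≠ a₂) (ho3 : o ≠ a₃) (hob : o ≠ b)
    (h13 : a₁ ≠ a₃) (hb1 : b ≠ a₁) (hb3 : b ≠ a₃) (p : E → R) (hp : IsProbVec p) :
    HCov p ends o a₁ a₂ a₃ b := by
  classical
  obtain ⟨e₁, eb, hS⟩ := exists_star_none_of_oTwoToMarks hsimp h ho3 ho1 hob h13.symm hb3.symm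
    hb1.symm ho2
  unfold HCov
  rw [Gc_eq_of_agree_nonLoop p (relocateO_agree ends o a₃) (relocateO_agree' ends o a₃)]
  exact CovForm.OStar.HCov_of_a3bstar hS p hp

end Mirrors

/-! ## The residual minus the two mirrors -/

section ClassOB

variable {V : Type*} {E : Type*} [Fintype E] [DecidableEq E] [DecidableEq V]

/-- **The residual minus the star of `b` and the `{a₃, b}`-star of `o`**. -/
structure WReducedOB (ends : E → Sym2 V) (o a₁ a₂ a₃ b : V) : Prop
    extends WReducedO ends o a₁ a₂ a₃ b where
  /-- not the star class of `b` -/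
  notBStar : ¬ OToMarks ends b a₁ a₂ o
  /-- not the `{a₃, b}`-star class of `o` -/
  notOA3B : ¬ OTwoToMarks ends o a₃ b

omit [DecidableEq E] in
/-- **On the residual `b` has a non-loop edge to a vertex other than `a₁`, `a₂`, `o`.** -/
theorem exists_b_edge_off_of_wredOB {ends : E → Sym2 V} {o a₁ a₂ a₃ b : V}
    (h : WReducedOB ends o a₁ a₂ a₃ b) :
    ∃ (e : E) (x : V), ends e = s(b, x) ∧ x ≠ b ∧ x ≠ a₁ ∧ x ≠ a₂ ∧ x ≠ o := by
  by_contra hc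
  push Not at hc
  apply h.notBStar
  intro e he hd
  obtain ⟨x, hx⟩ := Sym2.mem_iff_exists.mp he
  have hxb : x ≠ b := by
    intro hxb
    rw [hx, hxb, Sym2.mk_isDiag_iff] at hd
    exact hd rfl
  by_cases h1 : x = a₁
  · exact Or.inl (by rw [hx, h1])
  by_cases h2 : x = a₂
  · exact Or.inr (Or.inl (by rw [hx, h2]))
  by_cases ho : x = o
  · exact Or.inr (Or.inr (by rw [hx, ho]))
  exact absurd (hc e x hx hxb h1 h2) ho

omit [DecidableEq E] in
/-- **On the residual `o` has a non-loop edge to a vertex other than `a₃`, `b`.** -/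
theorem exists_o_edge_off_a3b_of_wredOB {ends : E → Sym2 V} {o a₁ a₂ a₃ b : V}
    (h : WReducedOB ends o a₁ a₂ a₃ b) :
    ∃ (e : E) (x : V), ends e = s(o, x) ∧ x ≠ o ∧ x ≠ a₃ ∧ x ≠ b := by
  by_contra hc
  push Not at hc
  apply h.notOA3B
  intro e he hd
  obtain ⟨x, hx⟩ := Sym2.mem_iff_exists.mp he
  have hxo : x ≠ o := by
    intro hxo
    rw [hx, hxo, Sym2.mk_isDiag_iff] at hd
    exact hd rfl
  by_cases h3 : x = a₃
  · exact Or.inl (by rw [hx, h3])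
  by_cases hb : x = b
  · exact Or.inr (by rw [hx, hb])
  exact absurd (hc e x hx hxo h3) hb

end ClassOB

section Closure

variable (R : Type*) [Field R] [LinearOrder R] [IsStrictOrderedRing R]

/-- **(HCOV) on the residual minus the two mirrors**. -/
def HCovWRedOB_all : Prop :=
  ∀ (V E : Type) [Fintype V] [DecidableEq V] [Fintype E] [DecidableEq E]
    (ends : E → Sym2 V) (p : E → R), IsProbVec p →
    ∀ o a₁ a₂ a₃ b : V, a₁ ≠ a₂ → a₁ ≠ a₃ → a₂ ≠ a₃ → o ≠ a₁ → o ≠ a₂ → o ≠ a₃ → o ≠ b →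
      b ≠ a₁ → b ≠ a₂ → b ≠ a₃ → WReducedOB ends o a₁ a₂ a₃ b → HCov p ends o a₁ a₂ a₃ b

end Closure

section Main

variable {R : Type*} [Field R] [LinearOrder R] [IsStrictOrderedRing R]

/-- The two mirror classes are theorems on the residual: no induction. -/
theorem HCovWRedO_all_of_HCovWRedOB_all (hB : HCovWRedOB_all R) : HCovWRedO_all R := by
  intro V E _ _ _ _ ends p hp o a₁ a₂ a₃ b h12 h13 h23 ho1 ho2 ho3 hob hb1 hb2 hb3 hred
  by_cases hS : OToMarks ends b a₁ a₂ o
  · exact HCov_of_bToMarks hred.simple hS hb1 hb2 hb3 hob h12 ho1 ho2 p hp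
  by_cases hS' : OTwoToMarks ends o a₃ b
  · exact HCov_of_oA3BToMarks hred.simple hS' ho1 ho2 ho3 hob h13 hb1 hb3 p hp
  exact hB V E ends p hp o a₁ a₂ a₃ b h12 h13 h23 ho1 ho2 ho3 hob hb1 hb2 hb3 ⟨hred, hS, hS'⟩

/-- **THE WEIGHTED RESIDUAL MINUS THE TWO MIRRORS**: (HCOV) for every finite weighted graph with
five distinct marks follows from (HCOV) on `WReducedOB`. -/
theorem HCov_all_of_HCovWRedOB_all (hB : HCovWRedOB_all R) : HCov_all R :=
  HCov_all_of_HCovWRedO_all (HCovWRedO_all_of_HCovWRedOB_all hB)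

/-- The residual minus the two mirrors is a faithful reduction. -/
theorem HCov_all_iff_HCovWRedOB_all : HCov_all R ↔ HCovWRedOB_all R :=
  ⟨fun h V E _ _ _ _ ends p hp o a₁ a₂ a₃ b h12 h13 h23 ho1 ho2 ho3 hob hb1 hb2 hb3 _ =>
    h V E ends p hp o a₁ a₂ a₃ b h12 h13 h23 ho1 ho2 ho3 hob hb1 hb2 hb3,
   HCov_all_of_HCovWRedOB_all⟩

/-- The residuals are equivalent closures. -/
theorem HCovWRedO_all_iff_HCovWRedOB_all : HCovWRedO_all R ↔ HCovWRedOB_all R := by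
  rw [← HCov_all_iff_HCovWRedO_all, ← HCov_all_iff_HCovWRedOB_all]

end Main

end WRed

end Summit.Ventures.PercRepro2
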